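import Summits.CriticalPhenomena.PercolationContinuityZ3.Theorems.PercNearOneGluingNoHeavyLowerTailKnQuestion8CoefficientwiseCoreClassKernelMixHubToggle
import Mathlib.Order.Interval.Finset.Nat
import HarnessLib

/-!
# The min-side matching μ₁ of the augmented staircase theorem, by parts (PATH LEMMA of hub-Kleitman, layer 2)

Support file (`--supports stmt-CriticalPhenomena-4575`, closed), prover `prim-cplus-coupling` (gen 51).  No definitions, no notations,
no named facts, no sorries; standard axioms.  Memo `prim-cplus-coupling/A5-COUPLING-gen51.md` §2 (Lemma 2.3).

The family `𝒱 = 𝔉 ∪ 𝒪` of the augmented staircase theorem splits, for the min-side map μ₁ ('toggle `t₁ X`'), into three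
invariant parts; this file proves that μ₁ is an involution on two of them (the third, 'toggle 0', is immediate and is done
in the assembly file):
* `hubStair_mu1_innerPart` — inner sets `X ⊆ [1,N-1]` whose cell `(min X, max X)` lies in the staircase `R` but not in the
  down-closed cell set `A` (row `y` of `R` is `[xi y, y]`, row `y` of `A` is `[1, alpha y]`), together with `∅` when
  `sA = dA` (diagonal extent = domino extent of `A`): toggle `θ (max X)`, `θ y = max (xi y) (alpha y + 1)` (`∅ ↦ {dA+1}`);
* `hubStair_mu1_topPart` — sets `Z ∪ {N}` with cell(Z) in the up-closed cell set `B` (row `y` of `B` is `[beta y, y]`),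
  together with `{N}` when `bd = db` (diagonal start = domino start of `B`): toggle `beta (max Z)` (`{N} ↦ {bd, N}`).
Both are instances of `minToggle_invol` (…KernelMixHubToggle).
[cite: KozmaNitzan2024, Questions 8–9 (§5.5 p. 36) (context)]
-/

namespace Summit.CriticalPhenomena.PercolationContinuityZ3.Theorems

open Finset
open scoped symmDiff

namespace Coefficientwise

/-- `X ∆ {a} = insert a X` when `a ∉ X`. [folklore] -/
theorem hub_symmDiff_singleton_eq_insert (X : Finset ℕ) (a : ℕ) (ha : a ∉ X) : X ∆ {a} = insert a X := by
  ext e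
  simp only [mem_symmDiff, mem_singleton, mem_insert]
  constructor
  · rintro (⟨he, _⟩ | ⟨rfl, _⟩)
    · exact Or.inr he
    · exact Or.inl rfl
  · rintro (rfl | he)
    · exact Or.inr ⟨rfl, ha⟩
    · exact Or.inl ⟨he, fun h => ha (h ▸ he)⟩

/-- `X ∆ {a} = X.erase a` when `a ∈ X`. [folklore] -/
theorem hub_symmDiff_singleton_eq_erase (X : Finset ℕ) (a : ℕ) (ha : a ∈ X) : X ∆ {a} = X.erase a := by
  ext e
  simp only [mem_symmDiff, mem_singleton, mem_erase]
  constructor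
  · rintro (⟨he, hne⟩ | ⟨rfl, hna⟩)
    · exact ⟨hne, he⟩
    · exact absurd ha hna
  · rintro ⟨hne, he⟩
    exact Or.inl ⟨he, hne⟩

/-- Toggling an element `t ≠ c` commutes with removing `c`: `(X ∆ {t}).erase c = (X.erase c) ∆ {t}`, and membership of `c`
is unchanged. [folklore] -/
theorem hub_symmDiff_singleton_erase_comm (X : Finset ℕ) (t c : ℕ) (htc : t ≠ c) :
    (X ∆ {t}).erase c = (X.erase c) ∆ {t} ∧ (c ∈ X ∆ {t} ↔ c ∈ X) := by
  constructor
  · ext e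
    simp only [mem_erase, mem_symmDiff, mem_singleton]
    constructor
    · rintro ⟨hne, (⟨he, het⟩ | ⟨rfl, hna⟩)⟩
      · exact Or.inl ⟨⟨hne, he⟩, het⟩
      · exact Or.inr ⟨rfl, fun h => hna h.2⟩
    · rintro (⟨⟨hne, he⟩, het⟩ | ⟨rfl, hna⟩)
      · exact ⟨hne, Or.inl ⟨he, het⟩⟩
      · exact ⟨htc, Or.inr ⟨rfl, fun h => hna ⟨htc, h⟩⟩⟩
  · simp only [mem_symmDiff, mem_singleton]
    constructor
    · rintro (⟨hc, _⟩ | ⟨rfl, _⟩)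
      · exact hc
      · exact absurd rfl htc
    · intro hc
      exact Or.inl ⟨hc, fun h => htc h.symm⟩

/-- **Fixed points of the row threshold θ.**  With row `y` of `A` equal to `[1, alpha y]` (down-closed `A` with diagonal
extent `sA` and domino extent `dA`, `dA ≤ sA ≤ dA+1`) and `1 ≤ xi y ≤ y`, `xi y ≤ y - 1` for `y ≥ 2`:
`max (xi y) (alpha y + 1) = y` iff `sA = dA` and `y = dA + 1`. [folklore] -/
theorem hubStair_theta_fix (N : ℕ) (xi alpha : ℕ → ℕ) (sA dA : ℕ) (A : Finset (ℕ × ℕ))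
    (hxi : ∀ y, 1 ≤ y → y ≤ N - 1 → 1 ≤ xi y ∧ xi y ≤ y)
    (hxi2 : ∀ y, 2 ≤ y → y ≤ N - 1 → xi y ≤ y - 1)
    (hArow : ∀ x y, (x, y) ∈ A ↔ 1 ≤ x ∧ x ≤ y ∧ y ≤ N - 1 ∧ x ≤ alpha y)
    (hAdiag : ∀ x, (x, x) ∈ A ↔ 1 ≤ x ∧ x ≤ sA)
    (hAdom : ∀ x, (x, x + 1) ∈ A ↔ 1 ≤ x ∧ x ≤ dA)
    (hsd : dA ≤ sA ∧ sA ≤ dA + 1)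
    (y : ℕ) (hy1 : 1 ≤ y) (hyN : y ≤ N - 1) :
    max (xi y) (alpha y + 1) = y ↔ (sA = dA ∧ y = dA + 1) := by
  have hx := hxi y hy1 hyN
  have hdiag : (y ≤ alpha y) ↔ (1 ≤ y ∧ y ≤ sA) := by
    rw [← hAdiag, hArow]; omega
  by_cases hy2 : 2 ≤ y
  · have hx2 := hxi2 y hy2 hyN
    have hdom : (y - 1 ≤ alpha y) ↔ (1 ≤ y - 1 ∧ y - 1 ≤ dA) := by
      rw [← hAdom (y - 1)]
      have : y - 1 + 1 = y := by omega
      rw [this, hArow]; omega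
    constructor
    · intro h
      have h1 : y - 1 ≤ alpha y := by omega
      have h2 := hdom.mp h1
      have h3 : ¬ (y ≤ alpha y) := by omega
      rw [hdiag] at h3
      omega
    · rintro ⟨hs, rfl⟩
      have h2 : dA + 1 - 1 ≤ alpha (dA + 1) := hdom.mpr ⟨by omega, by omega⟩
      have h3 : ¬ (dA + 1 ≤ alpha (dA + 1)) := by rw [hdiag]; omega
      omega
  · have hy : y = 1 := by omega
    subst hy
    constructor
    · intro h
      have h3 : ¬ (1 ≤ alpha 1) := by omega
      rw [hdiag] at h3
      omega
    · rintro ⟨hs, h1⟩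
      have h3 : ¬ (1 ≤ alpha 1) := by rw [hdiag]; omega
      omega

/-- **μ₁ on the inner part** (inner sets with cell in `R ∖ A`, plus `∅` iff `sA = dA`): toggling `θ (max X)`
(`dA + 1` for `∅`) preserves the part, returns the same toggled element, and toggles an element `≤ min X`. [folklore] -/
theorem hubStair_mu1_innerPart (N : ℕ) (xi alpha : ℕ → ℕ) (sA dA : ℕ) (A : Finset (ℕ × ℕ))
    (hxi : ∀ y, 1 ≤ y → y ≤ N - 1 → 1 ≤ xi y ∧ xi y ≤ y)
    (hxi2 : ∀ y, 2 ≤ y → y ≤ N - 1 → xi y ≤ y - 1)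
    (hArow : ∀ x y, (x, y) ∈ A ↔ 1 ≤ x ∧ x ≤ y ∧ y ≤ N - 1 ∧ x ≤ alpha y)
    (hAdiag : ∀ x, (x, x) ∈ A ↔ 1 ≤ x ∧ x ≤ sA)
    (hAdom : ∀ x, (x, x + 1) ∈ A ↔ 1 ≤ x ∧ x ≤ dA)
    (hsd : dA ≤ sA ∧ sA ≤ dA + 1) (hdN : dA + 1 ≤ N - 1)
    (a : Finset ℕ → ℕ)
    (ha : ∀ X : Finset ℕ, a X = if h : X.Nonempty then max (xi (X.max' h)) (alpha (X.max' h) + 1) else dA + 1)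
    (X : Finset ℕ)
    (hX : (X = ∅ ∧ sA = dA) ∨
      (X.Nonempty ∧ (∀ e ∈ X, 1 ≤ e ∧ e ≤ N - 1) ∧
        ∀ h : X.Nonempty, max (xi (X.max' h)) (alpha (X.max' h) + 1) ≤ X.min' h)) :
    ((X ∆ {a X} = ∅ ∧ sA = dA) ∨
      ((X ∆ {a X}).Nonempty ∧ (∀ e ∈ X ∆ {a X}, 1 ≤ e ∧ e ≤ N - 1) ∧
        ∀ h : (X ∆ {a X}).Nonempty,
          max (xi ((X ∆ {a X}).max' h)) (alpha ((X ∆ {a X}).max' h) + 1) ≤ (X ∆ {a X}).min' h)) ∧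
    a (X ∆ {a X}) = a X ∧ ∀ e ∈ X, a X ≤ e := by
  classical
  set θ : ℕ → ℕ := fun y => max (xi y) (alpha y + 1) with hθdef
  have hθfix := hubStair_theta_fix N xi alpha sA dA A hxi hxi2 hArow hAdiag hAdom hsd
  set I : Finset ℕ := (Finset.Icc 1 (N - 1)).filter (fun M => θ M ≤ M) with hIdef
  have hIiff : ∀ M, M ∈ I ↔ 1 ≤ M ∧ M ≤ N - 1 ∧ θ M ≤ M := by
    intro M; rw [hIdef, mem_filter, mem_Icc]; tauto
  -- translate the family
  have hK_of : ∀ Y : Finset ℕ,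
      ((Y = ∅ ∧ sA = dA) ∨ (Y.Nonempty ∧ (∀ e ∈ Y, 1 ≤ e ∧ e ≤ N - 1) ∧ ∀ h : Y.Nonempty, θ (Y.max' h) ≤ Y.min' h)) ↔
      ((Y = ∅ ∧ ∃ M ∈ I, θ M = M) ∨ (∃ h : Y.Nonempty, Y.max' h ∈ I ∧ ∀ e ∈ Y, θ (Y.max' h) ≤ e)) := by
    intro Y
    constructor
    · rintro (⟨rfl, hs⟩ | ⟨hne, hbd, hθ⟩)
      · left; refine ⟨rfl, dA + 1, ?_, ?_⟩
        · rw [hIiff]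
          have := (hθfix (dA + 1) (by omega) hdN).mpr ⟨hs, rfl⟩
          refine ⟨by omega, hdN, le_of_eq this⟩
        · exact (hθfix (dA + 1) (by omega) hdN).mpr ⟨hs, rfl⟩
      · right; refine ⟨hne, ?_, ?_⟩
        · rw [hIiff]
          have hm := hbd _ (max'_mem Y hne)
          exact ⟨hm.1, hm.2, (hθ hne).trans (min'_le Y _ (max'_mem Y hne))⟩
        · intro e he
          exact (hθ hne).trans (min'_le Y e he)
    · rintro (⟨rfl, M, hMI, hMfix⟩ | ⟨hne, hMI, hlow⟩)
      · left
        rw [hIiff] at hMI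
        exact ⟨rfl, ((hθfix M hMI.1 hMI.2.1).mp hMfix).1⟩
      · right
        rw [hIiff] at hMI
        refine ⟨hne, ?_, fun h => ?_⟩
        · intro e he
          have h1 := hlow e he
          have h2 : e ≤ Y.max' hne := le_max' Y e he
          have h3 : 1 ≤ θ (Y.max' hne) := by
            have := (hxi _ hMI.1 hMI.2.1).1
            show 1 ≤ max _ _
            omega
          omega
        · have : h = hne := rfl
          exact (le_min'_iff Y hne).mpr (hlow)
  have hgen := minToggle_invol I θ (dA + 1)
    (fun M hM => ((hIiff M).mp hM).2.2)
    (fun M hM M' hM' h1 h2 => by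
      rw [hIiff] at hM hM'
      have e1 := ((hθfix M hM.1 hM.2.1).mp h1).2
      have e2 := ((hθfix M' hM'.1 hM'.2.1).mp h2).2
      omega)
    (fun ⟨M, hM, hfix⟩ => by
      rw [hIiff] at hM
      have hs := ((hθfix M hM.1 hM.2.1).mp hfix).1
      have hf : θ (dA + 1) = dA + 1 := (hθfix (dA + 1) (by omega) hdN).mpr ⟨hs, rfl⟩
      exact ⟨(hIiff _).mpr ⟨by omega, hdN, le_of_eq hf⟩, hf⟩)
    a ha X ((hK_of X).mp hX)
  obtain ⟨h1, h2, h3⟩ := hgen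
  exact ⟨(hK_of _).mpr h1, h2, h3⟩

/-- **μ₁ on the top part** (sets `Z ∪ {N}` with cell(Z) ∈ `B`, plus `{N}` iff `bd = db`): toggling `beta (max Z)`
(`bd` for `{N}`) preserves the part, returns the same toggled element, and toggles an element `≤ min`. [folklore] -/
theorem hubStair_mu1_topPart (N : ℕ) (hN : 2 ≤ N) (beta : ℕ → ℕ) (bd db : ℕ) (B : Finset (ℕ × ℕ))
    (hBrow : ∀ x y, (x, y) ∈ B ↔ 1 ≤ x ∧ x ≤ y ∧ y ≤ N - 1 ∧ beta y ≤ x)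
    (hBdiag : ∀ x, (x, x) ∈ B ↔ 1 ≤ x ∧ bd ≤ x ∧ x ≤ N - 1)
    (hBdom : ∀ x, (x, x + 1) ∈ B ↔ 1 ≤ x ∧ db ≤ x ∧ x + 1 ≤ N - 1)
    (hbd : db ≤ bd ∧ bd ≤ db + 1) (hbd1 : 1 ≤ db) (hdbN : db ≤ N - 1)
    (hbeta1 : ∀ y, 1 ≤ beta y)
    (c : Finset ℕ → ℕ)
    (hc : ∀ X : Finset ℕ, c X = if h : (X.erase N).Nonempty then beta ((X.erase N).max' h) else bd)
    (X : Finset ℕ)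
    (hX : N ∈ X ∧ (∀ e ∈ X, e ≤ N) ∧
      ((X = {N} ∧ bd = db) ∨ ∃ h : (X.erase N).Nonempty, ((X.erase N).min' h, (X.erase N).max' h) ∈ B)) :
    (N ∈ X ∆ {c X} ∧ (∀ e ∈ X ∆ {c X}, e ≤ N) ∧
      ((X ∆ {c X} = {N} ∧ bd = db) ∨
        ∃ h : ((X ∆ {c X}).erase N).Nonempty, (((X ∆ {c X}).erase N).min' h, ((X ∆ {c X}).erase N).max' h) ∈ B)) ∧
    c (X ∆ {c X}) = c X ∧ ∀ e ∈ X, c X ≤ e := by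
  classical
  obtain ⟨hNX, hle, hrest⟩ := hX
  set Z := X.erase N with hZdef
  -- diagonal fixed points of beta
  have hβfix : ∀ y, 1 ≤ y → y ≤ N - 1 → beta y ≤ y → (beta y = y ↔ (bd = db ∧ y = bd)) := by
    intro y hy1 hyN hby
    have hd : (y, y) ∈ B := (hBrow y y).mpr ⟨hy1, le_rfl, hyN, hby⟩
    have hyb : bd ≤ y := ((hBdiag y).mp hd).2.1
    by_cases hy2 : 2 ≤ y
    · have hdom : (beta y ≤ y - 1) ↔ (db ≤ y - 1) := by
        have e1 : y - 1 + 1 = y := by omega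
        have h := hBdom (y - 1)
        rw [e1, hBrow] at h
        constructor
        · intro hh; exact (h.mp ⟨by omega, by omega, by omega, hh⟩).2.1
        · intro hh; exact (h.mpr ⟨by omega, hh, by omega⟩).2.2.2
      constructor
      · intro h
        have : ¬ beta y ≤ y - 1 := by omega
        rw [hdom] at this
        omega
      · rintro ⟨h1, h2⟩
        have : ¬ (db ≤ y - 1) := by omega
        rw [← hdom] at this
        omega
    · have hy : y = 1 := by omega
      subst hy
      have hb1 := hbeta1 1
      constructor
      · intro _; omega
      · intro _; omega
  set I : Finset ℕ := (Finset.Icc 1 (N - 1)).filter (fun y => beta y ≤ y) with hIdef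
  have hIiff : ∀ y, y ∈ I ↔ 1 ≤ y ∧ y ≤ N - 1 ∧ beta y ≤ y := by
    intro y; rw [hIdef, mem_filter, mem_Icc]; tauto
  -- the generic lemma on Z with τ = beta, M₀ = bd (an opaque name for the toggled element)
  obtain ⟨a, haY⟩ : ∃ a : Finset ℕ → ℕ, ∀ Y : Finset ℕ, a Y = if h : Y.Nonempty then beta (Y.max' h) else bd :=
    ⟨_, fun Y => rfl⟩
  have hfixI : (∃ M ∈ I, beta M = M) → bd = db := by
    rintro ⟨M, hM, hfix⟩
    rw [hIiff] at hM
    exact ((hβfix M hM.1 hM.2.1 hM.2.2).mp hfix).1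
  have hKZ : (Z = ∅ ∧ ∃ M ∈ I, beta M = M) ∨ (∃ h : Z.Nonempty, Z.max' h ∈ I ∧ ∀ e ∈ Z, beta (Z.max' h) ≤ e) := by
    rcases hrest with ⟨hXN, hbd'⟩ | ⟨hZne, hcell⟩
    · left
      have hZ : Z = ∅ := by rw [hZdef, hXN]; simp
      refine ⟨hZ, bd, ?_, ?_⟩
      · rw [hIiff]
        have hb : bd ≤ N - 1 := by omega
        have hd : (bd, bd) ∈ B := (hBdiag bd).mpr ⟨by omega, le_rfl, hb⟩
        exact ⟨by omega, hb, ((hBrow bd bd).mp hd).2.2.2⟩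
      · have hb : bd ≤ N - 1 := by omega
        have hd : (bd, bd) ∈ B := (hBdiag bd).mpr ⟨by omega, le_rfl, hb⟩
        exact (hβfix bd (by omega) hb ((hBrow bd bd).mp hd).2.2.2).mpr ⟨hbd', rfl⟩
    · right
      have hB := (hBrow _ _).mp hcell
      refine ⟨hZne, ?_, ?_⟩
      · rw [hIiff]
        exact ⟨by omega, hB.2.2.1, hB.2.2.2.trans hB.2.1⟩
      · intro e he
        exact hB.2.2.2.trans (min'_le Z e he)
  have hgen := minToggle_invol I beta bd
    (fun M hM => ((hIiff M).mp hM).2.2)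
    (fun M hM M' hM' h1 h2 => by
      rw [hIiff] at hM hM'
      have e1 := ((hβfix M hM.1 hM.2.1 hM.2.2).mp h1).2
      have e2 := ((hβfix M' hM'.1 hM'.2.1 hM'.2.2).mp h2).2
      omega)
    (fun hex => by
      have hbd' := hfixI hex
      have hb : bd ≤ N - 1 := by omega
      have hd : (bd, bd) ∈ B := (hBdiag bd).mpr ⟨by omega, le_rfl, hb⟩
      have hbb := ((hBrow bd bd).mp hd).2.2.2
      exact ⟨(hIiff bd).mpr ⟨by omega, hb, hbb⟩, (hβfix bd (by omega) hb hbb).mpr ⟨hbd', rfl⟩⟩)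
    a haY Z hKZ
  obtain ⟨hK', haa, hamin⟩ := hgen
  -- c X = a Z
  have hcX : c X = a Z := by rw [hc, haY]
  -- the toggled element is ≤ N - 1, hence ≠ N
  have haZ_le : a Z ≤ N - 1 := by
    rcases hKZ with ⟨hZ0, M, hM, hMf⟩ | ⟨hZne, hMI, _⟩
    · have hbd' := hfixI ⟨M, hM, hMf⟩
      have hZn : ¬ Z.Nonempty := by rw [hZ0]; exact Finset.not_nonempty_empty
      rw [haY, dif_neg hZn]
      omega
    · rw [haY, dif_pos hZne]; rw [hIiff] at hMI; exact hMI.2.2.trans hMI.2.1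
  have hN0 : 0 < N := Nat.lt_of_lt_of_le (Nat.succ_pos 1) hN
  have haZ_ltN : a Z < N := Nat.lt_of_le_of_lt haZ_le (Nat.sub_lt hN0 Nat.one_pos)
  have haN : a Z ≠ N := Nat.ne_of_lt haZ_ltN
  obtain ⟨hcomm, hmemN⟩ := hub_symmDiff_singleton_erase_comm X (a Z) N haN
  rw [hcX]
  have hZ' : (X ∆ {a Z}).erase N = Z ∆ {a Z} := by rw [hcomm]
  refine ⟨⟨hmemN.mpr hNX, ?_, ?_⟩, ?_, ?_⟩
  · intro e he
    rw [mem_symmDiff, mem_singleton] at he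
    rcases he with ⟨he, _⟩ | ⟨rfl, _⟩
    · exact hle e he
    · exact Nat.le_of_lt haZ_ltN
  · rcases hK' with ⟨hE, hex⟩ | ⟨hne', hMI', hlow'⟩
    · left
      refine ⟨?_, hfixI hex⟩
      -- X ∆ {a Z} has erase N = ∅ and contains N
      ext e
      constructor
      · intro he
        rw [mem_singleton]
        by_contra hne
        have : e ∈ (X ∆ {a Z}).erase N := mem_erase.mpr ⟨hne, he⟩
        rw [hZ', hE] at this
        simp at this
      · intro he
        rw [mem_singleton] at he
        rw [he]
        exact hmemN.mpr hNX
    · right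
      have hne'' : ((X ∆ {a Z}).erase N).Nonempty := by rw [hZ']; exact hne'
      refine ⟨hne'', ?_⟩
      have hmax : ((X ∆ {a Z}).erase N).max' hne'' = (Z ∆ {a Z}).max' hne' := by
        apply le_antisymm
        · apply max'_le; intro e he; rw [hZ'] at he; exact le_max' _ e he
        · apply max'_le; intro e he; rw [← hZ'] at he; exact le_max' _ e he
      have hmin : ((X ∆ {a Z}).erase N).min' hne'' = (Z ∆ {a Z}).min' hne' := by
        apply le_antisymm
        · apply le_min'; intro e he; rw [← hZ'] at he; exact min'_le _ e he
        · apply le_min'; intro e he; rw [hZ'] at he; exact min'_le _ e he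
      rw [hmax, hmin, hBrow]
      rw [hIiff] at hMI'
      have hlowmin : beta ((Z ∆ {a Z}).max' hne') ≤ (Z ∆ {a Z}).min' hne' :=
        (le_min'_iff _ hne').mpr hlow'
      have hb1 : 1 ≤ beta ((Z ∆ {a Z}).max' hne') := hbeta1 _
      exact ⟨le_trans hb1 hlowmin, min'_le _ _ (max'_mem _ hne'), hMI'.2.1, hlowmin⟩
  · -- c (X ∆ {a Z}) = a (Z ∆ {a Z}) = a Z
    rw [hc, hZ', ← haY]
    exact haa
  · intro e he
    by_cases heN : e = N
    · rw [heN]; exact Nat.le_of_lt haZ_ltN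
    · exact hamin e (mem_erase.mpr ⟨heN, he⟩)

end Coefficientwise

end Summit.CriticalPhenomena.PercolationContinuityZ3.Theorems
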